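import Summits.Ventures.PercRepro.KernelLaw3

/-!
# The candidate C-013 is false: a kernel-checked refutation

C-013 (`PercRepro.C013`, typer-2's `SMC.lean`; mine-1's M1-F5) asserts, for the partition law
`(x, y₁, y₂, y₃, z)` of three marked vertices, `(z + y₁ + y₂)(y₃ + x) ≤ (y₁ + y₂ + y₃)(z + y₁ + x)`.
mine-4's witness (INBOX 2026-08-22T04:02:45Z; re-enumerated exactly by the lead, 04:18:41Z):
`K₄` minus the edge `{b, c}` — vertices `a = 0, b = 1, c = 2, v = 3` — with the edge weights
`a–c = 99999/100000`, `a–b = 124/125`, `a–v = 3/5`, `b–v = 3/10`, `v–c = 3/10`.  Over the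
`32` edge configurations the five cells are
`(x, y₁, y₂, y₃, z) = (6210751311, 48671, 39199671, 18, 329) / 6250000000`
(the integer twin `law3NatTuple` computes the five numerators in one kernel pass: `law3NatTuple_k4mbc`),
and then `(z + y₁ + y₂)(y₃ + x) − (y₁ + y₂ + y₃)(z + y₁ + x) = 9080493799 / 6250000000² > 0`:
`not_C013`.  The first kernel-checked kill of a mined candidate in this cell.
-/

namespace PercRepro

namespace Examples

open MultiGraph

/-- mine-4's witness graph: `K₄` minus `{b, c}` with `a = 0`, `b = 1`, `c = 2`, `v = 3`; edges
`0: a–c`, `1: a–b`, `2: a–v`, `3: b–v`, `4: v–c`. -/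
def k4mbc : MultiGraph (Fin 4) (Fin 5) := ⟨![0, 0, 0, 1, 3], ![2, 1, 3, 3, 2]⟩

/-- Numerators of the witness weights `99999/100000, 124/125, 3/5, 3/10, 3/10`. -/
def c013num : Fin 5 → ℕ := ![99999, 124, 3, 3, 3]

/-- Denominators of the witness weights. -/
def c013den : Fin 5 → ℕ := ![100000, 125, 5, 10, 10]

/-- The witness weights as real edge probabilities. -/
noncomputable def c013p : Fin 5 → ℝ := fun e => (c013num e : ℝ) / c013den e

/-- The witness weights lie in `[0, 1]`. -/
theorem isProb_c013p : IsProb c013p := by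
  intro e
  fin_cases e <;> norm_num [c013p, c013num, c013den]

/-- The five cells of the witness in one kernel pass over the `32` configurations:
`(x, y₁, y₂, y₃, z) = (6210751311, 48671, 39199671, 18, 329) / 6250000000`. -/
theorem law3NatTuple_k4mbc :
    k4mbc.law3NatTuple 0 1 2 c013num c013den = (6210751311, 48671, 39199671, 18, 329) := by
  decide +kernel

/-- The five cells of the witness, as real row probabilities. -/
theorem law3_k4mbc :
    k4mbc.law3 c013p 0 1 2 0 = 6210751311 / 6250000000 ∧
    k4mbc.law3 c013p 0 1 2 1 = 48671 / 6250000000 ∧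
    k4mbc.law3 c013p 0 1 2 2 = 39199671 / 6250000000 ∧
    k4mbc.law3 c013p 0 1 2 3 = 18 / 6250000000 ∧
    k4mbc.law3 c013p 0 1 2 4 = 329 / 6250000000 := by
  have hab : ∀ e, c013num e ≤ c013den e := fun e => by
    fin_cases e <;> norm_num [c013num, c013den]
  have hb : ∀ e, 0 < c013den e := fun e => by
    fin_cases e <;> norm_num [c013den]
  have hprod : (∏ e, (c013den e : ℝ)) = 6250000000 := by
    simp [Fin.prod_univ_five, c013den]
    norm_num
  have h := k4mbc.law3_of_law3NatTuple c013num c013den hab hb 0 1 2 law3NatTuple_k4mbc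
  rw [hprod] at h
  exact h

/-- **C-013 is false**: on mine-4's witness the defect is `−9080493799 / 6250000000²`. -/
theorem not_C013 : ¬ C013 := by
  intro h
  have hc := h k4mbc c013p isProb_c013p 0 1 2
  obtain ⟨e0, e1, e2, e3, e4⟩ := law3_k4mbc
  rw [e0, e1, e2, e3, e4] at hc
  norm_num at hc

end Examples

end PercRepro
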